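import Mathlib
import Summits.Langlands.Langlands.Theorems.PhantomRMYoshidaResiduallyYoshidaLiftingBlockSumConj
import Summits.Langlands.Langlands.Theorems.PhantomRMYoshidaResiduallyYoshidaLiftingResidualTriangularAux
import Literature.RepresentationTheory.Semisimple.Semisimplification
import Literature.RepresentationTheory.Semisimple.BrauerNesbitt
import Literature.RepresentationTheory.Semisimple.SubrepresentationEquiv
import Literature.RepresentationTheory.Semisimple.BurnsideMatrixSpan

/-!
# Trace limits VI — residual matching of endoscopic components (route `PhantomRMYoshida`, crux
# `ResiduallyYoshidaLifting` = stmt-Langlands-13639, line `endoscopic-crossing-euler`, Stub 4)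

Companion of `…TraceLimit{,Endo,Pseudo,Unique,Idempotent}.lean` (`--supports stmt-Langlands-13639`).
Pure representation theory over fields, feeding the rigidity theorem of endoscopic components
(`norm_trace_sub_trace_le_of_residuallyConj`) with its residual hypotheses along the endoscopic
approximants `tr r'_n = tr a_n + tr d_n` of Stub 4: the reductions of `a_n`, `d_n` satisfy
`det(X - ā_n) det(X - d̄_n) = det(X - σ̄) det(X - σ̄')` with `σ̄ ≇ σ̄'` irreducible of rank `2`, and

* `equiv_of_conj`, `prodEquiv_of_blockDiag` — conjugate matrix representations are equivalent; the
  representation through a block-diagonal homomorphism is the product of the blocks;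
* `equiv_or_equiv_of_charpoly_mul` — **component extraction**: if `a, d, σ, σ' : Γ → GL₂(K)` are
  irreducible with `det(X - a) det(X - d) = det(X - σ) det(X - σ')`, then `a ≃ σ` or `a ≃ σ'`
  (block sums are conjugate by the landed `stub_blockSumConj`; project the first block and apply
  Schur, Mathlib `Representation.IsIrreducible.bijective_or_eq_zero`);
* `matching_of_charpoly_mul` (registered as `stub_endoComponentMatching`) — **matching**: with
  `σ ≄ σ'` moreover, `(a ≃ σ ∧ d ≃ σ') ∨ (a ≃ σ' ∧ d ≃ σ)`, and `a ≄ d`;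
* `isIrreducible_of_isIrreducible_map`, `isEmpty_equiv_of_isEmpty_equiv_map`,
  `exists_conj_of_equiv_map` — **descent along a field embedding `f : κ → k`** (`k` algebraically
  closed): irreducibility descends (Burnside, tree `span_eq_top_of_isIrreducible`,
  `span_range_map_eq_top_iff`, `isIrreducible_of_span_eq_top`), non-equivalence descends, and two
  irreducible `κ`-representations equivalent over `k` are conjugate over `κ` (Brauer–Nesbitt over
  `κ`, tree `Representation.nonempty_equiv_of_charpoly_eq`).

References: N. Bourbaki, *Algèbre* VIII § 20 n° 6 (Brauer–Nesbitt); C. W. Curtis, I. Reiner,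
*Representation theory of finite groups and associative algebras* (1962), (27.4), (29.13).
-/

noncomputable section

open scoped Matrix

namespace Summit.Langlands.Langlands.Cruxes.ResiduallyYoshidaLifting.EndoscopicCrossingEuler

set_option linter.dupNamespace false

open Literature.RepresentationTheory.Semisimple

/-- `Rep(K, n, φ)`: the representation of the group on `Kⁿ` through `φ : Γ → GL_n(K)` (local
notation for Mathlib's `Representation.ofDistribMulAction … ∘ φ`). -/
local notation "Rep(" K ", " n ", " φ ")" =>
  MonoidHom.comp (Representation.ofDistribMulAction K (GL (Fin n) K) (Fin n → K)) φ

section Field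

variable {K : Type} [Field K] {Γ : Type} [Group Γ]

/-! ### Conjugate representations are equivalent; block-diagonal = product -/

/-- Conjugate matrix representations `ψ₁ = h ψ₂ h⁻¹` give equivalent representations on `Kⁿ`
(the equivalence is `v ↦ h v`). [folklore] -/
theorem equiv_of_conj {n : ℕ} (ψ₁ ψ₂ : Γ →* GL (Fin n) K) (h : GL (Fin n) K)
    (hconj : ∀ g, ((ψ₁ g : GL (Fin n) K) : Matrix (Fin n) (Fin n) K) =
      (h : Matrix (Fin n) (Fin n) K) * (ψ₂ g : GL (Fin n) K) * ((h⁻¹ : GL (Fin n) K) : Matrix (Fin n) (Fin n) K)) :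
    Nonempty (Representation.Equiv Rep(K, n, ψ₂) Rep(K, n, ψ₁)) := by
  let E : (Fin n → K) ≃ₗ[K] (Fin n → K) :=
    { Matrix.toLin' (h : Matrix (Fin n) (Fin n) K) with
      invFun := Matrix.toLin' ((h⁻¹ : GL (Fin n) K) : Matrix (Fin n) (Fin n) K)
      left_inv := fun v => by
        simp only [AddHom.toFun_eq_coe, LinearMap.coe_toAddHom, Matrix.toLin'_apply, Matrix.mulVec_mulVec,
          ← Units.val_mul, inv_mul_cancel, Units.val_one, Matrix.one_mulVec]
      right_inv := fun v => by
        simp only [AddHom.toFun_eq_coe, LinearMap.coe_toAddHom, Matrix.toLin'_apply, Matrix.mulVec_mulVec,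
          ← Units.val_mul, mul_inv_cancel, Units.val_one, Matrix.one_mulVec] }
  refine ⟨Representation.Equiv.mk E fun g => LinearMap.ext fun v => ?_⟩
  change (h : Matrix (Fin n) (Fin n) K) *ᵥ (((ψ₂ g : GL (Fin n) K) : Matrix (Fin n) (Fin n) K) *ᵥ v) =
    ((ψ₁ g : GL (Fin n) K) : Matrix (Fin n) (Fin n) K) *ᵥ ((h : Matrix (Fin n) (Fin n) K) *ᵥ v)
  rw [hconj g, Matrix.mulVec_mulVec, Matrix.mulVec_mulVec]
  simp only [← Units.val_mul, inv_mul_cancel_right]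

/-- The representation through a block-diagonal homomorphism `ψ = A ⊕ D` (along
`e : Fin m ⊕ Fin p ≃ Fin n`) is equivalent to the product of the representations through the blocks
(the comparison isomorphism `(x, y) ↦ (x, y) ∘ e⁻¹`, as in tree
`isSemisimpleRepresentation_of_blockDiag`). [folklore] -/
theorem prodEquiv_of_blockDiag {m p n : ℕ} (e : Fin m ⊕ Fin p ≃ Fin n) {A : Γ →* GL (Fin m) K}
    {D : Γ →* GL (Fin p) K} {ψ : Γ →* GL (Fin n) K}
    (hψ : ∀ g, ((ψ g : GL (Fin n) K) : Matrix (Fin n) (Fin n) K) =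
      Matrix.reindex e e (Matrix.fromBlocks ((A g : GL (Fin m) K) : Matrix (Fin m) (Fin m) K) 0 0
        ((D g : GL (Fin p) K) : Matrix (Fin p) (Fin p) K))) :
    Nonempty (Representation.Equiv (Representation.prod Rep(K, m, A) Rep(K, p, D)) Rep(K, n, ψ)) := by
  classical
  let E : ((Fin m → K) × (Fin p → K)) ≃ₗ[K] (Fin n → K) :=
    (LinearEquiv.sumArrowLequivProdArrow (Fin m) (Fin p) K K).symm ≪≫ₗ LinearEquiv.funCongrLeft K K e.symm
  have hsum : ∀ (x : Fin m → K) (y : Fin p → K) (s : Fin m ⊕ Fin p),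
      (LinearEquiv.sumArrowLequivProdArrow (Fin m) (Fin p) K K).symm (x, y) s = Sum.elim x y s := by
    rintro x y (j | j) <;> simp
  have hE : ∀ (x : Fin m → K) (y : Fin p → K) (i : Fin n), E (x, y) i = Sum.elim x y (e.symm i) := by
    intro x y i
    simp only [E, LinearEquiv.trans_apply, LinearEquiv.funCongrLeft_apply, LinearMap.funLeft_apply, hsum]
  refine ⟨Representation.Equiv.mk E fun g => LinearMap.ext fun xy => ?_⟩
  obtain ⟨x, y⟩ := xy
  change E (((A g : GL (Fin m) K) : Matrix (Fin m) (Fin m) K) *ᵥ x,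
      ((D g : GL (Fin p) K) : Matrix (Fin p) (Fin p) K) *ᵥ y) =
    ((ψ g : GL (Fin n) K) : Matrix (Fin n) (Fin n) K) *ᵥ E (x, y)
  have hExy : E (x, y) = Sum.elim x y ∘ e.symm := funext (hE x y)
  rw [hExy, hψ g, Matrix.reindex_apply, Matrix.submatrix_mulVec_equiv]
  funext i
  rw [hE]
  simp only [Function.comp_apply, Equiv.symm_symm]
  rw [show (Sum.elim x y ∘ ⇑e.symm) ∘ ⇑e = Sum.elim x y from by funext j; simp, Matrix.fromBlocks_mulVec]
  simp

/-- Equivalent matrix representations have equal characteristic polynomials (the easy half of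
Brauer–Nesbitt: conjugation invariance, Mathlib `LinearEquiv.charpoly_conj`). [folklore] -/
theorem charpoly_eq_of_equiv {n n' : ℕ} {φ : Γ →* GL (Fin n) K} {φ' : Γ →* GL (Fin n') K}
    (E : Representation.Equiv Rep(K, n, φ) Rep(K, n', φ')) (g : Γ) :
    ((φ g : GL (Fin n) K) : Matrix (Fin n) (Fin n) K).charpoly =
      ((φ' g : GL (Fin n') K) : Matrix (Fin n') (Fin n') K).charpoly := by
  rw [← charpoly_glRep_apply φ g, ← charpoly_glRep_apply φ' g,
    ← Representation.Equiv.conj_apply_self g E, LinearEquiv.charpoly_conj]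

/-- An irreducible representation is semisimple. [folklore] -/
theorem isSemisimpleRepresentation_of_isIrreducible {V : Type} [AddCommGroup V] [Module K V]
    (ρ : Representation K Γ V) (h : ρ.IsIrreducible) : ρ.IsSemisimpleRepresentation := by
  haveI : IsSimpleOrder (Subrepresentation ρ) := h
  exact (inferInstance : ComplementedLattice (Subrepresentation ρ))

/-! ### Component extraction and matching -/

/-- **Component extraction.**  Let `a, d, σ, σ' : Γ → GL₂(K)` be irreducible on `K²` with
`det(X - a g) det(X - d g) = det(X - σ g) det(X - σ' g)` for all `g`.  Then `a ≃ σ` or `a ≃ σ'`: the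
block sums `a ⊕ d`, `σ ⊕ σ'` are conjugate (landed `stub_blockSumConj`, Brauer–Nesbitt in any
characteristic), so `a × d ≃ σ × σ'`; one of the two projections of `a ↪ a × d ≃ σ × σ'` is non-zero,
hence bijective (Schur). [folklore] -/
theorem equiv_or_equiv_of_charpoly_mul (a d σ σ' : Γ →* GL (Fin 2) K)
    (ha : Representation.IsIrreducible Rep(K, 2, a)) (hd : Representation.IsIrreducible Rep(K, 2, d))
    (hσ : Representation.IsIrreducible Rep(K, 2, σ)) (hσ' : Representation.IsIrreducible Rep(K, 2, σ'))
    (h : ∀ g, ((a g : GL (Fin 2) K) : Matrix (Fin 2) (Fin 2) K).charpoly *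
        ((d g : GL (Fin 2) K) : Matrix (Fin 2) (Fin 2) K).charpoly =
      ((σ g : GL (Fin 2) K) : Matrix (Fin 2) (Fin 2) K).charpoly *
        ((σ' g : GL (Fin 2) K) : Matrix (Fin 2) (Fin 2) K).charpoly) :
    Nonempty (Representation.Equiv Rep(K, 2, a) Rep(K, 2, σ)) ∨
      Nonempty (Representation.Equiv Rep(K, 2, a) Rep(K, 2, σ')) := by
  classical
  -- block sums and their conjugacy
  obtain ⟨hc, hhc⟩ := stub_blockSumConj K Γ a d σ σ' ha hd hσ hσ' h
  obtain ⟨ψ₁, hψ₁⟩ := exists_blockDiag_hom (k := K) (n := 4) finSumFinEquiv a d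
  obtain ⟨ψ₂, hψ₂⟩ := exists_blockDiag_hom (k := K) (n := 4) finSumFinEquiv σ σ'
  have hconj : ∀ g, ((ψ₁ g : GL (Fin 4) K) : Matrix (Fin 4) (Fin 4) K) =
      (hc : Matrix (Fin 4) (Fin 4) K) * (ψ₂ g : GL (Fin 4) K) * ((hc⁻¹ : GL (Fin 4) K) : Matrix (Fin 4) (Fin 4) K) :=
    fun g => by rw [hψ₁ g, hψ₂ g]; exact hhc g
  obtain ⟨E₁⟩ := prodEquiv_of_blockDiag (K := K) (m := 2) (p := 2) (n := 4) finSumFinEquiv hψ₁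
  obtain ⟨E₂⟩ := prodEquiv_of_blockDiag (K := K) (m := 2) (p := 2) (n := 4) finSumFinEquiv hψ₂
  obtain ⟨E₃⟩ := equiv_of_conj ψ₁ ψ₂ hc hconj
  -- `Φ : a × d ≃ σ × σ'`
  let Φ : Representation.Equiv (Representation.prod Rep(K, 2, a) Rep(K, 2, d))
      (Representation.prod Rep(K, 2, σ) Rep(K, 2, σ')) :=
    (E₁.trans E₃.symm).trans E₂.symm
  haveI : Representation.IsIrreducible Rep(K, 2, a) := ha
  haveI : Representation.IsIrreducible Rep(K, 2, σ) := hσ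
  haveI : Representation.IsIrreducible Rep(K, 2, σ') := hσ'
  let ι : Representation.IntertwiningMap Rep(K, 2, a) (Representation.prod Rep(K, 2, σ) Rep(K, 2, σ')) :=
    Φ.toIntertwiningMap.comp (Representation.IntertwiningMap.inl K Rep(K, 2, a) Rep(K, 2, d))
  let f₁ : Representation.IntertwiningMap Rep(K, 2, a) Rep(K, 2, σ) :=
    (Representation.IntertwiningMap.fst K Rep(K, 2, σ) Rep(K, 2, σ')).comp ι
  let f₂ : Representation.IntertwiningMap Rep(K, 2, a) Rep(K, 2, σ') :=
    (Representation.IntertwiningMap.snd K Rep(K, 2, σ) Rep(K, 2, σ')).comp ι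
  -- one of the projections is non-zero
  have hne : f₁ ≠ 0 ∨ f₂ ≠ 0 := by
    by_contra hboth
    push Not at hboth
    obtain ⟨h1, h2⟩ := hboth
    have hι : ∀ v : Fin 2 → K, ι v = 0 := fun v => by
      refine Prod.ext ?_ ?_
      · have := DFunLike.congr_fun h1 v; simpa [f₁] using this
      · have := DFunLike.congr_fun h2 v; simpa [f₂] using this
    have hinj : Function.Injective ι := fun v w hvw => by
      have := Φ.toLinearEquiv.injective (show Φ ((v, 0) : (Fin 2 → K) × (Fin 2 → K)) = Φ (w, 0) from hvw)
      exact (Prod.mk.inj this).1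
    have := hinj (show ι (Pi.single 0 1) = ι 0 by rw [hι, hι])
    simpa using congrFun this 0
  rcases hne with hne | hne
  · rcases Representation.IsIrreducible.bijective_or_eq_zero f₁ with hb | hb
    · exact Or.inl ⟨f₁.ofBijective hb⟩
    · exact (hne hb).elim
  · rcases Representation.IsIrreducible.bijective_or_eq_zero f₂ with hb | hb
    · exact Or.inr ⟨f₂.ofBijective hb⟩
    · exact (hne hb).elim

/-- **Residual matching of endoscopic components.**  Let `a, d, σ, σ' : Γ → GL₂(K)` with `σ`, `σ'`
irreducible and NOT equivalent, and `det(X - a g) det(X - d g) = det(X - σ g) det(X - σ' g)` for all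
`g`.  Then `a`, `d` are irreducible (landed `isIrreducible_of_charpoly_mul`), NOT equivalent to each
other, and either `a ≃ σ`, `d ≃ σ'` or `a ≃ σ'`, `d ≃ σ` (component extraction for `a` and for
`d`; two blocks of the same type would force `det(X - σ) = det(X - σ')`, i.e. `σ ≃ σ'` by
Brauer–Nesbitt). [folklore] -/
theorem matching_of_charpoly_mul (a d σ σ' : Γ →* GL (Fin 2) K)
    (hσ : Representation.IsIrreducible Rep(K, 2, σ)) (hσ' : Representation.IsIrreducible Rep(K, 2, σ'))
    (hne : IsEmpty (Representation.Equiv Rep(K, 2, σ) Rep(K, 2, σ')))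
    (h : ∀ g, ((a g : GL (Fin 2) K) : Matrix (Fin 2) (Fin 2) K).charpoly *
        ((d g : GL (Fin 2) K) : Matrix (Fin 2) (Fin 2) K).charpoly =
      ((σ g : GL (Fin 2) K) : Matrix (Fin 2) (Fin 2) K).charpoly *
        ((σ' g : GL (Fin 2) K) : Matrix (Fin 2) (Fin 2) K).charpoly) :
    Representation.IsIrreducible Rep(K, 2, a) ∧ Representation.IsIrreducible Rep(K, 2, d) ∧
      IsEmpty (Representation.Equiv Rep(K, 2, a) Rep(K, 2, d)) ∧
      ((Nonempty (Representation.Equiv Rep(K, 2, a) Rep(K, 2, σ)) ∧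
          Nonempty (Representation.Equiv Rep(K, 2, d) Rep(K, 2, σ'))) ∨
        (Nonempty (Representation.Equiv Rep(K, 2, a) Rep(K, 2, σ')) ∧
          Nonempty (Representation.Equiv Rep(K, 2, d) Rep(K, 2, σ)))) := by
  have h' : ∀ g, ((d g : GL (Fin 2) K) : Matrix (Fin 2) (Fin 2) K).charpoly *
        ((a g : GL (Fin 2) K) : Matrix (Fin 2) (Fin 2) K).charpoly =
      ((σ g : GL (Fin 2) K) : Matrix (Fin 2) (Fin 2) K).charpoly *
        ((σ' g : GL (Fin 2) K) : Matrix (Fin 2) (Fin 2) K).charpoly := fun g => by rw [mul_comm, h g]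
  have ha : Representation.IsIrreducible Rep(K, 2, a) := isIrreducible_of_charpoly_mul hσ hσ' a d h
  have hd : Representation.IsIrreducible Rep(K, 2, d) := isIrreducible_of_charpoly_mul hσ hσ' d a h'
  haveI := isSemisimpleRepresentation_of_isIrreducible _ hσ
  haveI := isSemisimpleRepresentation_of_isIrreducible _ hσ'
  -- two blocks of the same type `τ ∈ {σ, σ'}` are impossible
  have hcancel : ∀ {x y : Γ →* GL (Fin 2) K},
      (∀ g, ((x g : GL (Fin 2) K) : Matrix (Fin 2) (Fin 2) K).charpoly *
          ((y g : GL (Fin 2) K) : Matrix (Fin 2) (Fin 2) K).charpoly =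
        ((σ g : GL (Fin 2) K) : Matrix (Fin 2) (Fin 2) K).charpoly *
          ((σ' g : GL (Fin 2) K) : Matrix (Fin 2) (Fin 2) K).charpoly) →
      ∀ (τ : Γ →* GL (Fin 2) K), (τ = σ ∨ τ = σ') →
      Nonempty (Representation.Equiv Rep(K, 2, x) Rep(K, 2, τ)) →
      Nonempty (Representation.Equiv Rep(K, 2, y) Rep(K, 2, τ)) → False := by
    intro x y hxy τ hτ ⟨Ex⟩ ⟨Ey⟩
    have hστ : ∀ g, ((σ g : GL (Fin 2) K) : Matrix (Fin 2) (Fin 2) K).charpoly =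
        ((σ' g : GL (Fin 2) K) : Matrix (Fin 2) (Fin 2) K).charpoly := by
      intro g
      have hx := charpoly_eq_of_equiv Ex g
      have hy := charpoly_eq_of_equiv Ey g
      have hg := hxy g
      rw [hx, hy] at hg
      rcases hτ with rfl | rfl
      · exact mul_left_cancel₀ (Matrix.charpoly_monic _).ne_zero hg
      · exact (mul_right_cancel₀ (Matrix.charpoly_monic _).ne_zero hg).symm
    have hrep : ∀ g, (Rep(K, 2, σ) g).charpoly = (Rep(K, 2, σ') g).charpoly := fun g => by
      rw [charpoly_glRep_apply, charpoly_glRep_apply, hστ g]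
    exact hne.false (Classical.choice (Representation.nonempty_equiv_of_charpoly_eq _ _ hrep))
  refine ⟨ha, hd, ⟨fun Ead => ?_⟩, ?_⟩
  · -- `a ≃ d`: then both blocks have the type of `a`
    rcases equiv_or_equiv_of_charpoly_mul a d σ σ' ha hd hσ hσ' h with hEa | hEa
    · obtain ⟨Ea⟩ := hEa
      exact hcancel h σ (Or.inl rfl) ⟨Ea⟩ ⟨Ead.symm.trans Ea⟩
    · obtain ⟨Ea⟩ := hEa
      exact hcancel h σ' (Or.inr rfl) ⟨Ea⟩ ⟨Ead.symm.trans Ea⟩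
  · rcases equiv_or_equiv_of_charpoly_mul a d σ σ' ha hd hσ hσ' h with hEa | hEa <;>
      rcases equiv_or_equiv_of_charpoly_mul d a σ σ' hd ha hσ hσ' h' with hEd | hEd
    · exact (hcancel h σ (Or.inl rfl) hEa hEd).elim
    · exact Or.inl ⟨hEa, hEd⟩
    · exact Or.inr ⟨hEa, hEd⟩
    · exact (hcancel h σ' (Or.inr rfl) hEa hEd).elim

/-- **Registered sub-goal `stub_endoComponentMatching` of Stub 4** (the statement through which this
helper file lands, `--supports stmt-Langlands-13639`; = `matching_of_charpoly_mul` in closed form):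
residual matching of the endoscopic components against the residual pair `(σ, σ')`. [folklore] -/
theorem stub_endoComponentMatching :
    ∀ (K : Type) [Field K] (Γ : Type) [Group Γ] (a d σ σ' : Γ →* GL (Fin 2) K),
      Representation.IsIrreducible ((Representation.ofDistribMulAction K (GL (Fin 2) K) (Fin 2 → K)).comp σ) →
      Representation.IsIrreducible ((Representation.ofDistribMulAction K (GL (Fin 2) K) (Fin 2 → K)).comp σ') →
      IsEmpty (Representation.Equiv ((Representation.ofDistribMulAction K (GL (Fin 2) K) (Fin 2 → K)).comp σ)
        ((Representation.ofDistribMulAction K (GL (Fin 2) K) (Fin 2 → K)).comp σ')) →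
      (∀ g, (a g).val.charpoly * (d g).val.charpoly = (σ g).val.charpoly * (σ' g).val.charpoly) →
      Representation.IsIrreducible ((Representation.ofDistribMulAction K (GL (Fin 2) K) (Fin 2 → K)).comp a) ∧
      Representation.IsIrreducible ((Representation.ofDistribMulAction K (GL (Fin 2) K) (Fin 2 → K)).comp d) ∧
      IsEmpty (Representation.Equiv ((Representation.ofDistribMulAction K (GL (Fin 2) K) (Fin 2 → K)).comp a)
        ((Representation.ofDistribMulAction K (GL (Fin 2) K) (Fin 2 → K)).comp d)) ∧
      ((Nonempty (Representation.Equiv ((Representation.ofDistribMulAction K (GL (Fin 2) K) (Fin 2 → K)).comp a)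
            ((Representation.ofDistribMulAction K (GL (Fin 2) K) (Fin 2 → K)).comp σ)) ∧
          Nonempty (Representation.Equiv ((Representation.ofDistribMulAction K (GL (Fin 2) K) (Fin 2 → K)).comp d)
            ((Representation.ofDistribMulAction K (GL (Fin 2) K) (Fin 2 → K)).comp σ'))) ∨
        (Nonempty (Representation.Equiv ((Representation.ofDistribMulAction K (GL (Fin 2) K) (Fin 2 → K)).comp a)
            ((Representation.ofDistribMulAction K (GL (Fin 2) K) (Fin 2 → K)).comp σ')) ∧
          Nonempty (Representation.Equiv ((Representation.ofDistribMulAction K (GL (Fin 2) K) (Fin 2 → K)).comp d)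
            ((Representation.ofDistribMulAction K (GL (Fin 2) K) (Fin 2 → K)).comp σ)))) :=
  fun _ _ _ _ a d σ σ' hσ hσ' hne h => matching_of_charpoly_mul a d σ σ' hσ hσ' hne h

end Field

/-! ### Descent along a field embedding `f : κ → k` -/

section Descent

variable {κ : Type} [Field κ] {k : Type} [Field k] {Γ : Type} [Group Γ]

/-- **Irreducibility descends** along a field embedding into an algebraically closed field: if
`f ∘ φ : Γ → GL_n(k)` is irreducible on `kⁿ` then `φ : Γ → GL_n(κ)` is irreducible on `κⁿ`
(Burnside over `k`: the `f(φ g)` span `M_n(k)`, so the `φ g` span `M_n(κ)`, tree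
`span_eq_top_of_isIrreducible`, `span_range_map_eq_top_iff`, `isIrreducible_of_span_eq_top`).
[folklore] -/
theorem isIrreducible_of_isIrreducible_map [IsAlgClosed k] {n : ℕ} (hn : 0 < n) (f : κ →+* k)
    (φ : Γ →* GL (Fin n) κ)
    (h : Representation.IsIrreducible Rep(k, n, (Matrix.GeneralLinearGroup.map f).comp φ)) :
    Representation.IsIrreducible Rep(κ, n, φ) := by
  haveI : Representation.IsIrreducible
      ((Literature.NumberTheory.GaloisRepresentations.glStdRepresentation (Fin n) k).comp
        ((Matrix.GeneralLinearGroup.map f).comp φ)) := h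
  have hspan := span_eq_top_of_isIrreducible ((Matrix.GeneralLinearGroup.map f).comp φ)
  have hspan' : Submodule.span k
      (Set.range fun g => (((φ g : GL (Fin n) κ) : Matrix (Fin n) (Fin n) κ)).map f) = ⊤ := hspan
  rw [span_range_map_eq_top_iff] at hspan'
  exact isIrreducible_of_span_eq_top hn φ hspan'

/-- Characteristic polynomials of the extension of scalars. [folklore] -/
theorem charpoly_map_comp_apply {n : ℕ} (f : κ →+* k) (φ : Γ →* GL (Fin n) κ) (g : Γ) :
    ((((Matrix.GeneralLinearGroup.map f).comp φ) g : GL (Fin n) k) : Matrix (Fin n) (Fin n) k).charpoly =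
      (((φ g : GL (Fin n) κ) : Matrix (Fin n) (Fin n) κ).charpoly).map f := by
  rw [coe_map_comp_apply, Matrix.charpoly_map]

/-- **Non-equivalence descends**: irreducible `φ, φ' : Γ → GL(κ)` which become equivalent over `κ`
have equal characteristic polynomials, hence so do `f ∘ φ`, `f ∘ φ'`, which are then equivalent over
`k` by Brauer–Nesbitt (irreducible, hence semisimple); contrapositively `f ∘ φ ≄ f ∘ φ'` gives
`φ ≄ φ'`. [folklore] -/
theorem isEmpty_equiv_of_isEmpty_equiv_map {n n' : ℕ} (f : κ →+* k) (φ : Γ →* GL (Fin n) κ)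
    (φ' : Γ →* GL (Fin n') κ)
    (hφ : Representation.IsIrreducible Rep(k, n, (Matrix.GeneralLinearGroup.map f).comp φ))
    (hφ' : Representation.IsIrreducible Rep(k, n', (Matrix.GeneralLinearGroup.map f).comp φ'))
    (h : IsEmpty (Representation.Equiv Rep(k, n, (Matrix.GeneralLinearGroup.map f).comp φ)
      Rep(k, n', (Matrix.GeneralLinearGroup.map f).comp φ'))) :
    IsEmpty (Representation.Equiv Rep(κ, n, φ) Rep(κ, n', φ')) := by
  refine ⟨fun E => h.false ?_⟩
  haveI := isSemisimpleRepresentation_of_isIrreducible _ hφ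
  haveI := isSemisimpleRepresentation_of_isIrreducible _ hφ'
  refine Classical.choice (Representation.nonempty_equiv_of_charpoly_eq _ _ fun g => ?_)
  rw [charpoly_glRep_apply, charpoly_glRep_apply, charpoly_map_comp_apply, charpoly_map_comp_apply,
    charpoly_eq_of_equiv E g]

/-- **Equivalence over `k` gives conjugacy over `κ`** for irreducible `κ`-representations of the
same rank: `f ∘ φ ≃ f ∘ φ'` gives equal characteristic polynomials over `k`, hence over `κ`
(`Polynomial.map f` is injective), hence `φ ≃ φ'` over `κ` by Brauer–Nesbitt, i.e. an intertwining
invertible matrix `P` with `φ' = P φ P⁻¹`. [folklore] -/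
theorem exists_conj_of_equiv_map {n : ℕ} (f : κ →+* k) (φ φ' : Γ →* GL (Fin n) κ)
    (hφ : Representation.IsIrreducible Rep(κ, n, φ)) (hφ' : Representation.IsIrreducible Rep(κ, n, φ'))
    (h : Nonempty (Representation.Equiv Rep(k, n, (Matrix.GeneralLinearGroup.map f).comp φ)
      Rep(k, n, (Matrix.GeneralLinearGroup.map f).comp φ'))) :
    ∃ P : GL (Fin n) κ, ∀ g, ((φ' g : GL (Fin n) κ) : Matrix (Fin n) (Fin n) κ) =
      (P : Matrix (Fin n) (Fin n) κ) * (φ g : GL (Fin n) κ) * ((P⁻¹ : GL (Fin n) κ) : Matrix (Fin n) (Fin n) κ) := by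
  obtain ⟨E⟩ := h
  haveI := isSemisimpleRepresentation_of_isIrreducible _ hφ
  haveI := isSemisimpleRepresentation_of_isIrreducible _ hφ'
  have hcp : ∀ g, (Rep(κ, n, φ') g).charpoly = (Rep(κ, n, φ) g).charpoly := fun g => by
    rw [charpoly_glRep_apply, charpoly_glRep_apply]
    apply Polynomial.map_injective f f.injective
    rw [← charpoly_map_comp_apply, ← charpoly_map_comp_apply, charpoly_eq_of_equiv E g]
  obtain ⟨e⟩ := Representation.nonempty_equiv_of_charpoly_eq _ _ hcp
  -- the matrix `H` of `e : φ' ≃ φ` and its inverse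
  set L : (Fin n → κ) ≃ₗ[κ] (Fin n → κ) := e.toLinearEquiv with hL
  set H : Matrix (Fin n) (Fin n) κ := LinearMap.toMatrix' (L : (Fin n → κ) →ₗ[κ] (Fin n → κ)) with hH
  set H' : Matrix (Fin n) (Fin n) κ := LinearMap.toMatrix' (L.symm : (Fin n → κ) →ₗ[κ] (Fin n → κ)) with hH'
  have hHH' : H * H' = 1 := by
    rw [hH, hH', ← LinearMap.toMatrix'_comp, LinearEquiv.comp_symm, LinearMap.toMatrix'_id]
  have hH'H : H' * H = 1 := by
    rw [hH, hH', ← LinearMap.toMatrix'_comp, LinearEquiv.symm_comp, LinearMap.toMatrix'_id]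
  have hlin : ∀ (ψ : Γ →* GL (Fin n) κ) (g : Γ), LinearMap.toMatrix' (Rep(κ, n, ψ) g : (Fin n → κ) →ₗ[κ] (Fin n → κ)) =
      ((ψ g : GL (Fin n) κ) : Matrix (Fin n) (Fin n) κ) := fun ψ g => by
    have : (Rep(κ, n, ψ) g : (Fin n → κ) →ₗ[κ] (Fin n → κ)) =
        Matrix.toLin' ((ψ g : GL (Fin n) κ) : Matrix (Fin n) (Fin n) κ) :=
      LinearMap.ext fun v ↦ by rw [Matrix.toLin'_apply]; rfl
    rw [this, LinearMap.toMatrix'_toLin']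
  have hint : ∀ g, H * ((φ' g : GL (Fin n) κ) : Matrix (Fin n) (Fin n) κ) =
      ((φ g : GL (Fin n) κ) : Matrix (Fin n) (Fin n) κ) * H := fun g ↦ by
    have h1 : (L : (Fin n → κ) →ₗ[κ] (Fin n → κ)) ∘ₗ (Rep(κ, n, φ') g) =
        (Rep(κ, n, φ) g) ∘ₗ (L : (Fin n → κ) →ₗ[κ] (Fin n → κ)) := e.toIntertwiningMap.isIntertwining' g
    have h2 := congrArg LinearMap.toMatrix' h1
    rw [LinearMap.toMatrix'_comp, LinearMap.toMatrix'_comp, hlin, hlin] at h2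
    exact h2
  refine ⟨⟨H', H, hH'H, hHH'⟩, fun g ↦ ?_⟩
  change ((φ' g : GL (Fin n) κ) : Matrix (Fin n) (Fin n) κ) = H' * ((φ g : GL (Fin n) κ) : Matrix (Fin n) (Fin n) κ) * H
  calc ((φ' g : GL (Fin n) κ) : Matrix (Fin n) (Fin n) κ)
      = (H' * H) * ((φ' g : GL (Fin n) κ) : Matrix (Fin n) (Fin n) κ) := by rw [hH'H, Matrix.one_mul]
    _ = H' * (H * ((φ' g : GL (Fin n) κ) : Matrix (Fin n) (Fin n) κ)) := by rw [Matrix.mul_assoc]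
    _ = H' * ((φ g : GL (Fin n) κ) : Matrix (Fin n) (Fin n) κ) * H := by rw [hint g, Matrix.mul_assoc]

end Descent

end Summit.Langlands.Langlands.Cruxes.ResiduallyYoshidaLifting.EndoscopicCrossingEuler

end
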